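import Mathlib
import HarnessLib
import HarnessLib.Audit
import Summits.KontsevichZagierPeriods.Statement
import Literature.Geometry.IntegralGeometry.HermitianHitting
import HarnessLib.Audit.Status.Attr

/-!
Route: KinematicFormulas

DORMANT since 2026-08-23T17:57:08Z (reconciler: no traction for 6.2 d (last activity item-evidence-added at 2026-08-17T13:35:17Z); parked, not closed — `ledger route dormant route-KontsevichZagierPeriods-KinematicFormulas --off` to reac) — unstaffed, not closed; items shared with open routes are served there. `ledger route dormant <id> --off` reactivates.

# Route KinematicFormulas — integral geometry inside the rules — kinematic formulas are chains of
moves; the unitary (Bernig–Fu) constants are the bet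

X = KinematicPlaneConvexR ∧ KinematicKernelR ("it suffices to show X"). Card realised:
integral-geometry-kinematic-formulas-compile.
INTEGRAL GEOMETRY IS A SUB-CALCULUS OF KZ, in Crofton/hitting form: motion groups and affine
Grassmannians are rational varieties
with rational invariant densities (tan-half-angle, Cayley, stereographic charts) and the incidence
sets {g : K ∩ gL ≠ ∅},
{E : E ∩ K ≠ ∅} of ℚ-semialgebraic bodies are ℚ-semialgebraic (Tarski–Seidenberg, proved in tree),
so every kinematic formula
is an identity among KZ-RATIONAL representations — volumes of incidence varieties — with
coefficients in ℚ[π], i.e. a family of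
quadratic instances of Conjecture 1 whose classical direct proofs are move chains.
KinematicPlaneConvexR (ENGINE, theorem-candidate,
repaired 2026-08-15): for all NON-EMPTY compact convex ℚ-semialgebraic K, L ⊂ ℝ², Blaschke's
principal kinematic formula
m{g ∈ SE(2) : K ∩ gL ≠ ∅} = 2π(A_K + A_L) + L_K·L_L, with L_K = m{lines meeting K} (Crofton), is a
CHAIN: [Inc(K,L), 2/(1+t²)] −
[ℝ_t × K] − [ℝ_t × L] − [LineHit K × LineHit L] ∈ KZ.relations. (Its predecessor
KinematicPlaneConvex, stmt-5394, quantified over ALL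
compact convex bodies including ∅ and was refuted-misstated by the witness K = [0,1]², L = ∅ —
Theorems/KinematicFormulasKinematicPlaneConvexRefutation.lean;
its want was dropped from the route on repair and the false statement stays indexed as negative
knowledge — `ledger negatives`.) KinematicKernelR (TARGET, GPC-strength, stated openly): the kernel
conjecture of the
calculus KZ^kin = the four moves + these plane kinematic relators for non-empty bodies ("freshman
calculus with Blaschke's formula as a
rule" — the working calculus of geometric probability); modulo the engine it is equivalent to
Literature.NumberTheory.Transcendental.KZKernelConjecture.
Ranked rungs toward the hermitian frontier: UnitaryKinematicC2 (rank 2, THE BET, typed 2026-08-15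
over the landed charts of
Literature/Geometry/IntegralGeometry/HermitianHitting.lean: the unitary principal kinematic formula
of ℂ² as a chain, 2π·m{g ∈ U(2)⋉ℂ² : K ∩ gL ≠ ∅}
= [products of hitting representations] with the integer coefficients 1, 1, 3, 3, 6, −8, −8, 32
forced by the calibration below), UnitaryDiscPair
(typed: the flat end of hermitian integral geometry, the (ℂ,ℂ):(ℂ,Lagrangian) = 2:1 instance) and
PoincareConics (typed: the area formula with multiplicity).
Lean: `KinematicPlaneConvexR ∧ KinematicKernelR`

## Assembly
Deciding theorem (D-0027 §2.1), PROVED and certified natively (planner folder Sketch.lean /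
glue.lean, lean check rc 0, 0 sorries, axioms
propext · Classical.choice · Quot.sound): `theorem closes (hE : KinematicPlaneConvexR) (hK :
KinematicKernelR) : KontsevichZagierPeriods` —
unfold the summit to KZ.Equivalent r r′, i.e. [r] − [r′] ∈ KZ.relations; `AddSubgroup.closure_le`
with KZ.domainAddRel_subset_relations,
KZ.integrandAddRel_subset_relations, KZ.changeOfVariablesRel_subset_relations,
KZ.newtonLeibnizRel_subset_relations and hE for the fifth
generator set gives closure(generators of KZ^kin) ≤ KZ.relations, and hK applied to [r] − [r′]
(value 0 by KZ.eval_of) lands in that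
closure. The statement item `Assembly` was RESTATED to `KinematicPlaneConvexR → KinematicKernelR →
KontsevichZagierPeriods` (stmt-11057, replacing
stmt-5399 whose hypothesis KinematicPlaneConvex was refuted; it is exactly the curried type of
`closes` and is provable by `fun hE hK => closes hE hK`
from a Theorems file); the old target KinematicKernel (stmt-5393, fifth generator set admitting ∅,
hence unsound generators) is superseded by
KinematicKernelR and dropped. The rungs UnitaryDiscPair, PoincareConics, CroftonEllipse and
SchurSO3 are not in the implication chain: they are the route's ladder toward the hermitian
frontier.

Rationale: WHY THIS LINE. The classical direct proofs of the kinematic formulas (Crofton–Cauchy, Poincaré,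
Blaschke–Santaló, Chern–Federer; SantaloKac2004
§§I.3, I.6–7, III.15; SchneiderWeil2008) become move chains once angles are rationalised: Fubini
along the motion group is a shear
(u, φ) ↦ (u, u − φ) on a torus, i.e. ONE change of variables with Jacobian 1 in tan-half-angle
charts (Möbius subtraction); the only
rule-3 steps are fibre identities such as ∫|sin ψ|dψ = 4 and Cauchy's projection formula, with
RATIONAL primitives on sign cells;
isotropy (Haar) averages of polynomial integrands are FINITE averages over rational rotations
(Schur/Weingarten, CollinsSniady2006),
so no limit or measure-theoretic averaging enters. This makes the valuation sector a second source
of accessible QUADRATIC period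
identities (products of arc-length/curvature periods of different curves, forced by Künneth along
the group action) disjoint from the
Riemann-bilinear/cup-product ones of routes MultivaluedCoV and the unfolding cards. Imported area:
integral geometry and valuation
theory (Hadwiger's theorem as in SchneiderWeilLNM2007 Thm 1.2–1.5, Alesker2003, Fu1990, Howard1993,
BernigFu2011). The frontier is
documented in print: hermitian kinematic formulas EXIST (Fu1990; Alesker's finiteness) but their
constants are known only through
Alesker's algebra of valuations (product, Fourier transform, hard Lefschetz: BernigFu2011) or, for n
= 2, 3, through Park's template
method (Park2002; "appears intractable" in general, BernigFu2011 §1.1) — neither is a derivation for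
a GIVEN pair of bodies, which is
exactly what Conjecture 1 predicts must exist. No prior route, card route or negative of this summit
touches integral geometry.

RANKED CRUXES. #0 KinematicKernelR (target) — kernel conjecture of the enlarged calculus KZ^kin:
every formal ℤ-combination of integral representations with value 0 lies in the subgroup generated
by domain additivity, integrand additivity, change of variables, Newton–Leibniz AND the plane
principal-kinematic relators of KinematicPlaneConvexR (same data: NON-EMPTY compact convex
ℚ-semialgebraic K, L ⊂ ℝ², the four reps r₀, r₁, r₂, r₃). Honest status: modulo
KinematicPlaneConvexR it is EQUIVALENT to Literature.NumberTheory.Transcendental.KZKernelConjecture,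
hence GPC-strength; filed so that the engine is load-bearing in the deciding theorem and KZ^kin is
on record as a formal object. Supersedes KinematicKernel (stmt-5393), whose relator set admitted K =
∅ / L = ∅ and therefore unsound generators (refuter note 2026-08-15). (why it might fail:
GPC-strength (the strength barriers bite here and only here); false iff some equal-valued pair stays
underivable even with kinematic relators adjoined — route Neg's candidate witnesses
(Gauss-triplication pair, regularised MZV relations) are untouched by them.) [KontsevichZagier2001,
HuberMullerStach2017, BernigFu2011]
#2 UnitaryKinematicC2 (crux) — THE BET, TYPED (card frontier (d); informal item stmt-6399 given its
signature on 2026-08-15 once defn-HermitianHittingRep had landed as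
Literature/Geometry/IntegralGeometry/HermitianHitting.lean). For all NON-EMPTY compact convex
ℚ-semialgebraic K, L ⊂ ℂ² = ℝ⁴: with g = (u, v), u = [[α, −λβ̄],[β, λᾱ]] in the S³×S¹ chart of
UnitaryDiscPair (x₀,x₁,x₂ ↦ (α,β) = (C2.stereoAlpha, C2.stereoBeta), x₃ ↦ λ, Haar density
16/(D³(1+x₃²)), total U(2)-mass 4π³), v = (x₄+x₅i, x₆+x₇i), one spectator circle coordinate x₈ with
density 2/(1+x₈²) (mass 2π, absorbing the odd powers of π), and the hitting sets/densities
C2.RealLine.hit/.density (chart |w|<1, 8/D³), C2.ComplexLine (ℝ⁴, (1+|m|²)⁻³), C2.LagrangianPlane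
(ℝ⁵, det(1+S²)⁻²), C2.RealHyperplane ({p ≥ 0}, 8/D³): r₀ = [ℝ_{x₈} × Inc(K,L)] (Inc = {g : ∃ q ∈ L,
u q + v ∈ K}, u q = (α z₁ − λβ̄ z₂, β z₁ + λᾱ z₂)), r₁ = [ℝ × U(2)-chart × K], r₂ = [ℝ × U(2)-chart
× L], r₃ = [ℝ × RealLine.hit K × RealHyperplane.hit L], r₄ = [ℝ × RealHyperplane.hit K ×
RealLine.hit L], r₅ = [ℝ × ℝ × ComplexLine.hit K × ComplexLine.hit L], r₆ = [ℝ × ComplexLine.hit K ×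
LagrangianPlane.hit L], r₇ = [ℝ × LagrangianPlane.hit K × ComplexLine.hit L], r₈ =
[LagrangianPlane.hit K × LagrangianPlane.hit L] (product densities): KZ.of r₀ − KZ.of r₁ − KZ.of r₂
− 3•KZ.of r₃ − 3•KZ.of r₄ − 6•KZ.of r₅ + 8•KZ.of r₆ + 8•KZ.of r₇ − 32•KZ.of r₈ ∈ KZ.relations. VALUE
SIDE = the hermitian principal kinematic formula of ℂ² in the hitting basis: m(K,L) = 4π³(vol K +
vol L) + 3(μ_RL(K)μ_RH(L) + μ_RH(K)μ_RL(L)) + 12π μ_C(K)μ_C(L) − 8(μ_C(K)μ_Lg(L) + μ_Lg(K)μ_C(L)) +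
(16/π) μ_Lg(K)μ_Lg(L), times 2π. The existence of such a bilinear formula in Val^{U(2)} ⊗ Val^{U(2)}
(dims 1,1,2,1,1 by degree; μ_C, μ_Lg independent in degree 2 by the Klain determinant 1/8) is
Fu1990/Alesker2003/BernigFu2011; the CONSTANTS were obtained here by calibration, not read off
BernigFu2011's Tasaki matrices: Haar mass 4π³ and m(B_r,B_s) = 2π⁵(r+s)⁴ give c₀ = 4π³ and c₁₃ = 3
(μ_RL(B_r) = 4π³r³/3, μ_RH(B_s) = 2π²s); the three disc pairs m(D_ℂ,D_ℂ) = 2π⁵, m(D_ℂ,D_ℝ) = π⁵,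
m(D_ℝ,D_ℝ) = 3π⁵/2 (translation-fibre volume π²|sin θ₁ sin θ₂|, Haar means 1/2, 1/4, 3/8 —
Monte-Carlo 0.5003, 0.2498, 0.3751, planner folder num/haar_means.py; the 3/8 also by exact
quadrature in eigen-coordinates, num/lagrangian_checks.py) with μ_C(D_ℂ, D_ℝ, B) = π²/2, π²/4, π²
and μ_Lg(D_ℂ, D_ℝ, B) = π³/4, 3π³/8, π³ (HermitianHitting.lean docstring values, two re-derived
here) give 12π, −8, 16/π; FOUR INDEPENDENT CHECKS then pass exactly: the ball r²s² coefficient 12π⁵,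
and m(B_r, D_ℂ) = m(B_r, D_ℝ) = 4π³(π²r² + (4π²/3)r³ + (π²/2)r⁴) (Steiner with V₁(disc) = π,
μ_RH(disc) = 4π²/3) in the r² AND r³ coefficients. Foreseen chain = glued split HowardTransferC2
(moving-frame fibre integration with U(1)-isotropy compiles for given K, L) → IsotropyConstantsC2
(the finitely many isotropy integrals of UnitaryDiscPair type). [difficulty: XL] (why it might fail:
All proofs are algebraic (Alesker, BernigFu2011: product, Fourier, hard Lefschetz) or by templates
(Park2002); a chain must evaluate Kähler-angle isotropy integrals by moves — any needing an
arctan-of-angle primitive is barred (noSemialgebraicPrimitive_inv_sub_two); as typed, a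
mis-normalised density or constant makes the values differ and ¬ is provable by soundness (forces a
restate, not a pivot).) [BernigFu2011, arXiv:0801.0711, Alesker2003, Fu1990, Howard1993, Park2002]
#2 KinematicPlaneConvexR (crux, co-ranked 2 with the bet: the engine is the hardest item a prover
can start on today) — THE PLANE ENGINE, repaired (card items (C)+(K): Crofton, Cauchy,
Blaschke–Santaló, torus shear). For all NON-EMPTY compact convex ℚ-semialgebraic K, L ⊂ ℝ² and
representations r₀ = [Inc(K,L), 2/(1+t²)] on SE(2) ∋ g = (t, v₁, v₂), t = tan(φ/2), g·q = R_φ q + v,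
Inc(K,L) = {g : ∃ q ∈ L, g·q ∈ K}; r₁ = [ℝ_t × K, 2/(1+t²)]; r₂ = [ℝ_t × L, 2/(1+t²)]; r₃ = [LineHit
K × LineHit L, 4/((1+t²)(1+t′²))] with lines (t, p), p ≥ 0, LineHit K = {(t,p) : ∃ q ∈ K, q·n_φ =
p}, n_φ = ((1−t²), 2t)/(1+t²): KZ.of r₀ − KZ.of r₁ − KZ.of r₂ − KZ.of r₃ ∈ KZ.relations. Values (all
non-empty pairs, incl. points and segments with perimeter 2V₁): m(Inc) = ∫dφ·A(K ⊕ (−R_φL)) = 2πA_K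
+ 2πA_L + L_K·L_L (SchneiderWeilLNM2007 Thm 1.5 with d = 2, j = 0, times the rotation mass 2π;
checked by hand: two unit discs 8π² = 8π², two segments 4ab = 4ab, disc + segment of length ℓ: 2π² +
4πℓ = 2π(π + 0) + 2π·2ℓ, point + body 2πA_L) and m(LineHit K) = L_K for every position of K (pairing
φ ↔ φ+π). The predecessor KinematicPlaneConvex (stmt-5394, all compact convex bodies incl. ∅) is
refuted-misstated (K = [0,1]², L = ∅: values 0, 2π, 0, 0) and stays as a negative edge. Foreseen
chain: fibre over t = area of K ⊕ (−R_φL) by the support/Gauss-map CoV and NL in the radial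
variable; integrand additivity splits (h_K + h_L)(ρ_K + ρ_L); the cross term decouples under the
torus shear (u, φ) ↦ (u, u − φ) (Möbius map, Jacobian 1) into the PRODUCT [ℝ, ρ_K dφ]·[ℝ, h_L dφ];
Cauchy (one NL, primitive h′) and Crofton (one NL in p) turn both factors into LineHit reps;
polygons/edges contribute atomic surface-area measure handled by domain additivity. [difficulty: L]
(why it might fail: Only as a UNIFORM derivability claim: edges, corners, lower-dimensional K
degenerate the Gauss-map parametrisation of ∂(K ⊕ −R_φL), so one chain schema must stratify every
non-empty convex semialgebraic body exactly (limits are not moves); values agree by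
Blaschke+Crofton.) [SantaloKac2004, SchneiderWeilLNM2007, SchneiderWeil2008, KontsevichZagier2001]
#4 UnitaryDiscPair (crux) — THE FLAT END OF HERMITIAN INTEGRAL GEOMETRY (card frontier (d), first
rung). Coordinates x ∈ ℝ⁸ on U(2)⋉ℂ²: (x₀,x₁,x₂) ↦ (α, β) ∈ S³ ⊂ ℂ² by inverse stereographic
projection (α = (2x₀+2x₁i)/D, β = (2x₂ + (|w|²−1)i)/D, D = 1+|w|²), x₃ ↦ λ = ((1−x₃²)+2x₃i)/(1+x₃²)
∈ S¹, u = [[α, −λβ̄],[β, λᾱ]] (a bijection S³×S¹ → U(2) pushing round×round to Haar), v = (x₄+x₅i,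
x₆+x₇i), Haar density 16/(D³(1+x₃²)). K = closed unit disc of the complex line ℂe₁; L = K; L′ =
closed unit disc of the Lagrangian plane ℝ² ⊂ ℂ²; Inc(K,M) = {(u,v) : ∃ p ∈ M, up + v ∈ K} written
out quantifier-explicitly. Claim: KZ.of [Inc(K,L), haar] − 2 • KZ.of [Inc(K,L′), haar] ∈
KZ.relations — a random unitary motion makes a Lagrangian disc meet a complex disc exactly HALF as
often as a complex disc (the two pairs are congruent under SO(4)⋉ℝ⁴, so the identity is invisible to
real integral geometry: it is the (2,2) Kähler-angle constant at its flat end). Values: translation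
fibres have 4-volume π²|β|² resp. π²|Im(β̄λᾱ)|, with Haar means 1/2 and 1/4 (Archimedes on S³;
B(3/2,3/2) = π/8 = area of a half-disc of radius 1/2); Monte-Carlo of the coordinate formulas, fibre
volumes and means in the planner folder num/unitary_disc_mc.py (0.5000, 0.2498). Foreseen chain (~25
moves): CoV (u,p,q) ↦ (u, p − uq) on the transversal locus (product structure [U(2),
|det(P,uQ)|·haar]·[D]·[D]); shear λ ↦ λ·conj(αβ)/|αβ| on S¹; sign-cell NL of |sin ψ| (rational
primitive); Archimedes CoV (|α|² = s) on S³; circle-versus-disc [ℝ, 2/(1+t²)] ~ 2·[unit disc, 1]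
(polar CoV + NL) to trade the 2π of the S¹ factor against 16·[half-disc of radius 1/2]. [difficulty:
M] (why it might fail: The 2π of the S¹ factor must be traded for 16 half-discs of radius 1/2 inside
an 8-dim chain with transversality null sets; as typed, a slip in the conj/sign conventions of u or
the Haar density's form makes the values differ and then ¬ is provable by soundness.) [BernigFu2011,
Alesker2003, Howard1993, KontsevichZagier2001]
#5 PoincareConics (crux) — POINCARÉ'S FORMULA WITH THE COUNTING INTEGRAND (card item (K), Poincaré).
For rational a, b, c, d > 0, E = {b²x² + a²y² ≤ a²b²}, E′ = {d²x² + c²y² ≤ c²d²}: r₀ = [ℝ³ = SE(2),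
#(∂E ∩ g∂E′)·2/(1+t²)] (integrand via Set.ncard; g⁻¹q = R_(−φ)(q − v); the count is ≤ 4 off the null
set of g with gE′ = E) and r₃ = [LineHit E × LineHit E′, 4/((1+t²)(1+t′²))] satisfy KZ.of r₀ − 4 •
KZ.of r₃ ∈ KZ.relations (Poincaré ∫#(∂E ∩ g∂E′)dg = 4·L_E·L_E′, SantaloKac2004 §I.7, checked by hand
on two circles: 16π²R₀R₁ both sides; Crofton for the lengths). Mechanism: Federer's AREA FORMULA
with variable multiplicity for the semialgebraic map (s, s′, ψ) ↦ g (contact parametrisation,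
Jacobian |sin ψ|) — route MultivaluedCoV's SheetTransfer with a piecewise-constant sheet count —
plus ∫|sin ψ|dψ = 4 as one Newton–Leibniz move per sign cell with a rational primitive, plus
CroftonEllipse twice. [difficulty: M] (why it might fail: The multiplicity #(∂E∩g∂E′) ∈ {0,…,4}
jumps across the tangency discriminant (degree 8 in g); the chain needs an explicit semialgebraic
partition of (s,s′,ψ)-space into injectivity sheets of the contact map plus the ncard integrand's
semialgebraicity — heavy bookkeeping in dim 3.) [SantaloKac2004, Howard1993, BCR1998]
#9 CroftonEllipse (support) — Crofton–Cauchy for the ellipse, the cheapest calibration (card item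
(C)): for rational a, b > 0, KZ.of [LineHit(E_(a,b)), 2/(1+t²)] − KZ.of [ℝ, 2√(4a²s² +
b²(1−s²)²)/(1+s²)²] ∈ KZ.relations — the measure of lines meeting the ellipse equals its perimeter
4aE(e), a complete elliptic integral of the second kind (KontsevichZagier2001 §1.1 lists it among
the first periods), here as arc length over the rational parametrisation s ↦ (a(1−s²)/(1+s²),
2bs/(1+s²)). Two or three moves: NL in p (primitive 2p/(1+t²)), then the Möbius quarter-turn t ↦
(1+t)/(1−t) exchanging the support-function and speed integrands of the ellipse, plus null-set
bookkeeping. [difficulty: provable-now] [SantaloKac2004, KontsevichZagier2001]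
#9 SchurSO3 (support) — FINITE AVERAGING calibrated (card item (F)): Schur orthogonality ∫_SO(3)
R₁₁² dg = (1/3)∫_SO(3) dg inside the rules. Gnomonic Euler–Rodrigues coordinates w ∈ ℝ³ (unit
quaternion (1,w)/√(1+|w|²), one chart for SO(3) = ℝP³ up to a null set), Haar density EXACTLY
(1+|w|²)⁻² (total mass π² = vol ℝP³), R₁₁ = (1 + x² − y² − z²)/(1+|w|²): 3 • KZ.of [ℝ³, R₁₁²·haar] −
KZ.of [ℝ³, haar] ∈ KZ.relations. Chain: left multiplication by the rotations of the cube that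
permute the coordinate axes is a RATIONAL measure-preserving change of variables w ↦ w′ (quaternion
product, defined off a null plane) carrying R₁₁² to R₂₁², R₃₁²; integrand additivity and R₁₁² + R₂₁²
+ R₃₁² = 1 close it — Haar integration (Weingarten calculus, CollinsSniady2006) replaced by finitely
many rational rotations, no limits. [difficulty: provable-now] [CollinsSniady2006,
KontsevichZagier2001]

TWO-LAYER PLAN. Foreseen glued splits (k ≤ 3, depth 1), filed only after a crux closes or stalls
with a census: KinematicPlaneConvexR ⇐
SmoothStrictlyConvexBodies (Nash boundary: Gauss-map CoV + torus shear) → EdgesAndCorners (atomic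
surface-area measure of flat
edges, corner sectors) → KinematicPlaneConvexR by semialgebraic stratification of ∂K, ∂L;
UnitaryKinematicC2 (once re-filed with a signature) ⇐ HowardTransferC2
(moving-frame fibre integration with U(1)-isotropy compiles for given K, L) → IsotropyConstantsC2
(the finitely many isotropy
integrals = the Bernig–Fu constants in ℚ[π], each a small Conjecture-1 instance of UnitaryDiscPair
type) → UnitaryKinematicC2;
PoincareConics ⇐ AreaFormulaTransfer (Federer's area formula with semialgebraic multiplicity as a
derived rule, generalising
MultivaluedCoV.SheetTransfer) → SineFibre (∫|sin ψ| = 4 by sign cells) → PoincareConics.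

KILL CRITERIA. Every typed item is an accessibility statement whose two sides are CERTIFIED equal
(Blaschke, Crofton, Poincaré; UnitaryDiscPair by
the computation recorded above): a genuine non-derivability proof for any of them refutes the SUMMIT
— report to the operator, close
this route `refuted:<Decl>` and hand the witness to route Neg. A refutation merely 'as typed'
(values differ because a coordinate or
density convention slipped, or a degenerate instance such as ∅ was admitted — as happened to
KinematicPlaneConvex, stmt-5394) forces a repaired re-filing (KinematicPlaneConvexR), not a pivot.
The route's BET dies if UnitaryKinematicC2 is shown underivable
while KinematicPlaneConvexR and UnitaryDiscPair land: then the Kähler-angle valuations (μ_2,0 versus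
μ_2,1) are the first
integral-geometric obstruction class — close the route refuted at that item and file the witness
with Neg. KZKernelConjecture settled
elsewhere (either way) moots the target; MultivaluedCoV.SheetTransfer landing first shortens
PoincareConics.

NOT DECOMPOSED YET. The foreseen split of the bet (UnitaryKinematicC2 ⇐ HowardTransferC2 →
IsotropyConstantsC2) is filed only after KinematicPlaneConvexR or UnitaryDiscPair closes or
UnitaryKinematicC2 stalls with a census; an independent reading of the ℂ² constants off
BernigFu2011's Tasaki/Crofton matrices (n = 2) is left to the grounder of UnitaryKinematicC2 (the
calibration here is over-determined and consistent, but a printed cross-check is still wanted). The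
general hermitian statement (all n; Bernig–Fu constants through Alesker's Fourier transform) is not
filed; Chern–Federer in ℝ³ (SO(3)⋉ℝ³ in Cayley coordinates: same
schema, more normalisations to certify); Steiner–Weyl tube formulas (polynomial-in-ε Jacobians:
provable now, left to provers as
`--supports` lemmas of KinematicPlaneConvexR); the finite-averaging lemma in general (existence of
the averaging words is
representation theory outside KZ; only its SO(3) calibration is filed); AreaFormulaTransfer as a
general derived rule (needs
semialgebraic trivialisation; layer-2 child of PoincareConics); completeness of the valuation sector
(would need Chudnovsky-type
independence of π, E(e), K(e): NOT claimed anywhere in this route).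

CHEAPEST FALSIFIER. Value audits, cheapest first: (i) SchurSO3 and CroftonEllipse by one-dimensional
quadrature in any CAS; (ii) KinematicPlaneConvexR on
K = L = unit disc (8π² = 8π², done by hand), on a segment against a disc (2π² + 4πℓ, done), on two
segments (4ab, done), on two rational rectangles, and on the DEGENERATE instances a refuter tries
first (points, segments: values still agree with perimeter = 2V₁; ∅ is now excluded by hypothesis —
it killed the predecessor); (iii)
UnitaryDiscPair: the two Haar means (Monte-Carlo done: 0.5000 and 0.2498 against 1/2 and 1/4, folder
num/unitary_disc_mc.py) — a
refuter should re-derive the translation-fibre volumes π²|β|² and π²|Im(β̄λᾱ)| symbolically from the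
typed set descriptions; (iv)
the lookup that would kill the BET's novelty: a direct moving-frame derivation of k_U(2)(χ) for
arbitrary convex bodies already in
print (Park2002 is template-based according to BernigFu2011 §1.1; Tasaki's Poincaré formulas cover
submanifolds of complementary
dimension only). (v) UnitaryKinematicC2: re-run the calibration (planner folder num/haar_means.py,
num/lagrangian_checks.py: Haar means 1/2, 1/4, 3/8; constants 12π, −8, 16/π; ball and ball–disc
checks exact), then audit pairs OUTSIDE the calibration set: K = B⁴ against a segment of length ℓ is
done here (only the (4,0) and (3,1) terms survive; μ_RH(segment) = (ℓ/2)∫_{S³}|v₀|dσ = 4πℓ/3 and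
both sides equal 2π⁵ + (16π⁴/3)ℓ — a seventh consistent check, this one of the constant 3); a
refuter should take two rational boxes or an ellipsoid against a disc (hitting integrals by
quadrature) and, independently, read the n = 2 constants off BernigFu2011 §5 / Park2002.

NUMBERS. dim Val^U(2) = 6 versus dim Val^SO(4) = 5 (BernigFu2011 §§2–3: the extra class lives in
degree 2, μ_2,0 and μ_2,1); Haar means for
unit discs in ℂ²: E|β|² = 1/2 (complex–complex), E|Im(β̄λᾱ)| = 1/4 (complex–Lagrangian); SO(3): ∫_ℝ³
(1+|w|²)⁻² dw = π² = vol ℝP³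
and ∫R₁₁² = π²/3; plane: rotation mass 2π, m{lines ∩ B_r ≠ ∅} = 2πr, Blaschke constant check 2π·4π =
2π(π+π) + (2π)²; Poincaré
constant 4 = ∫₀^2π |sin ψ| dψ. Items after the 2026-08-15 repair: 6 active typed (target
KinematicKernelR; cruxes KinematicPlaneConvexR r2, UnitaryDiscPair r4, PoincareConics r5; support
CroftonEllipse, SchurSO3) + the refuted negative edge KinematicPlaneConvex; dropped: KinematicKernel
(superseded), Assembly (replaced by the deciding theorem), UnitaryKinematicC2 (informal, parked in
NOT DECOMPOSED YET). Hermitian ℂ² constants (hitting basis, Haar mass 4π³): c₀ = 4π³ (vol ⊗ χ), c₁₃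
= 3 (RealLine ⊗ RealHyperplane), (2,2) block c_CC = 12π, c_CL = −8, c_LL = 16/π; calibration data
μ_RL(B) = 4π³/3, μ_RH(B) = 2π², μ_RH(disc) = 4π²/3, μ_C(B, D_ℂ, D_ℝ) = π², π²/2, π²/4, μ_Lg(B, D_ℂ,
D_ℝ) = π³, π³/4, 3π³/8, m(B_r,B_s) = 2π⁵(r+s)⁴, m(D_ℂ,D_ℂ) = 2π⁵, m(D_ℂ,D_ℝ) = π⁵, m(D_ℝ,D_ℝ) =
3π⁵/2, m(B_r, disc) = 4π⁵r² + (16π⁵/3)r³ + 2π⁵r⁴.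

DEFINITION REQUESTS. HermitianHittingRep — LANDED 2026-08-15 as
Literature/Geometry/IntegralGeometry/HermitianHitting.lean (defn-HermitianHittingRep,
literature-prover): C2.zfst/zsnd, C2.stereoAlpha/Beta/Den, C2.hitSet and
C2.{Point,RealLine,ComplexLine,LagrangianPlane,RealHyperplane}.{carrier,chart,density,hit} with
semialgebraicity lemmas (isSemialgebraic_hit, isSemialgebraicFunOn_density) and the documented value
checks used above; UnitaryKinematicC2 is typed over it. Still wanted as a cite fact (not
load-bearing for any typed item): BernigFu2011's k_U(2)(χ) in the Crofton basis, constants only, as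
an independent cross-check of 12π, −8, 16/π, 3, 4π³.

Novelty: Searches (2026-08-15): `lit search --hybrid "kinematic formula Crofton integral geometry"` (8 held
books; Weil (ed.) LNM 1892 =
SchneiderWeilLNM2007 READ pp. 104, 113–115: Thm 1.3 Crofton, Thm 1.4 Hadwiger's general
integral-geometric theorem, Thm 1.5
principal kinematic formula, all proved through Hadwiger's characterisation — a soft proof, not a
chain; Gardner 2006; Spodarev
2013); `lit search --hybrid "Kontsevich Zagier period conjecture Crofton formula perimeter ellipse"`
(paper:arxiv-1407.2388 = KZ
'What is a period' p. 4: the perimeter of an ellipse as a period, no integral geometry;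
book:huber2022: none); `lit search --source
zbmath "principal kinematic formula unitary group"` (1 hit: BernigFu2011); `lit read
arxiv:0801.0711` (READ §1.1: existence by
Fu1990/Alesker, constants by templates "appears intractable", Park2002 for n = 2, 3; §5 explicit
formulas via the sl₂-structure);
`lit galaxy search "kinematic formula" --star all` (12 hits: robotics, random nodal geometry, none
on periods); `lit frontier
KontsevichZagierPeriods --since 2020` (30 rows, none integral-geometric); `lit books --grep
"Santal|Schneider|Integral Geometry"`
(Santaló, Schneider–Weil 2008, Klain–Rota not held: cited by DOI); the card corpus of this
sub-problem (`ledger idea list`, 127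
cards: one incidental sentence in every-valley-is-a-peak-common-unfolding) and all ten route files
(none integral-geometric);
`ledger negatives` (0).
Nearest prior art found: SantaloKac2004 and SchneiderWeilLNM2007 Thm  [refs: 10.4007/annals.2011.173.2.7, 0801.0711, paper:arxiv-1407.2388, book:huber2022, arxiv:0801.0711, doi:10.4007/annals.2011.173.2.7, SchneiderWeilLNM2007, BernigFu2011, Fu1990, Park2002, SantaloKac2004, Alesker2003]

Barriers (technique_class: integral-geometry, kinematic-formula, valuation-sector): - technique_class: integral-geometry, kinematic-formula, valuation-sector
- Literature.Barriers.KontsevichZagierPeriods.noSemialgebraicPrimitive_inv_sub_two: evaded where it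
matters, respected where it bites — the only rule-3 steps in the plane and flat-hermitian chains are
∫|sin ψ| (primitive ∓cos ψ, rational in tan(ψ/2) on sign cells), Cauchy's projection formula
(primitive h′_K, semialgebraic) and polynomial-in-radius primitives; full-circle factors ∫dφ = 2π
are NEVER integrated out (2/(1+t²) has no semialgebraic primitive over ℝ — the barrier's own
mechanism) but carried as [ℝ, 2/(1+t²)] or traded for disc areas by the polar change of variables;
the bet UnitaryKinematicC2 is precisely where an isotropy integral might demand an
arctan-of-Kähler-angle primitive, and that is its declared failure mode.
- Literature.Barriers.KontsevichZagierPeriods.cressonViuSos_prop_3_2: respected — every chain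
dissects first (injectivity sheets of the contact/moving-frame map, sign cells of sin ψ,
transversality null sets) and maps the pieces; no global scissors-free semialgebraic map between an
incidence solid and a product of hitting solids is claimed.
- Literature.Barriers.KontsevichZagierPeriods.kzConjecture_implies_oddZetaAlgIndep: bites ONLY the
target KinematicKernel (GPC-strength, said openly in the thesis); every crux/support item is an
unconditional accessibility statement between representations with certified equal values
(second-kind elliptic integrals, areas, powers of π) and a

History (route lifecycle, newest last):
- 2026-08-15T13:50:46Z · BROKEN — KinematicPlaneConvex (stmt-KontsevichZagierPeriods-5394, crux) refuted by Summit.KontsevichZagierPeriods.KinematicFormulas.KinematicFormulasKinematicPlaneConvex_refuted @ 22f638522b28 (refuter-rreview-route-ValiantsHypothesis-c4867a2e-0)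
- 2026-08-15T16:39:54Z · rev 3: restated Assembly (stmt-KontsevichZagierPeriods-5399) — repair step 1/2: restate Assembly over the repaired items (KinematicPlaneConvex stmt-5394 refuted-misstated, L = ∅ witness → KinematicPlaneConvexR stmt-10736; K (planner-rbadge-KontsevichZagierPeriods-Kinemat-a9ca20ad-g2-0)
- 2026-08-15T16:40:47Z · rev 4: dropped KinematicKernel — repair step 2/2: deciding theorem closes (hE : KinematicPlaneConvexR) (hK : KinematicKernelR) : KontsevichZagierPeriods (glue.lean; lean check rc0, 0 sorries; n (planner-rbadge-KontsevichZagierPeriods-Kinemat-a9ca20ad-g2-0)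
- 2026-08-15T16:43:29Z · rev 5: dropped KinematicPlaneConvex — repair 3/3: drop the want of the refuted-MISSTATED item KinematicPlaneConvex (stmt-5394; witness K=[0,1]², L=∅, Theorems/KinematicFormulasKinematicPlaneConvexRe (planner-rbadge-KontsevichZagierPeriods-Kinemat-a9ca20ad-g2-0)
- 2026-08-15T16:43:29Z · REPAIRED (drop KinematicPlaneConvex) — back to open: repair 3/3: drop the want of the refuted-MISSTATED item KinematicPlaneConvex (stmt-5394; witness K=[0,1]², L=∅, Theorems/KinematicFormulasKinematicPlaneConvexRe (planner-rbadge-KontsevichZagierPeriods-Kinemat-a9ca20ad-g2-0)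
- 2026-08-16T02:18:03Z · AUTO-CRUX: 1 conjecture-grade item(s) promoted to crux (KinematicKernelR) — refuter vetting / tiering apply (operator:999:1362873)
- 2026-08-16T04:08:45Z · AUTO-CRUX (backfill): KinematicKernelR — hypotheses of the deciding theorem that nothing in the route derives are cruxes (operator:999:1085951)
- 2026-08-23T17:57:08Z · DORMANT — reconciler: no traction for 6.2 d (last activity item-evidence-added at 2026-08-17T13:35:17Z); parked, not closed — `ledger route dormant route-KontsevichZagier (operator:999:1786763)

sub-problem: KontsevichZagierPeriods · status: dormant · opened planner-plancard-KontsevichZagierPeriods-Kont-afe2bff2-0 2026-08-15T11:41:01Z · rev 9 · ledger route-KontsevichZagierPeriods-KinematicFormulas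
GENERATED by the gate from the ledger (D-0016/17). Provers cite these decls: `theorem foo : Summit.KontsevichZagierPeriods.KontsevichZagierPeriods.Theses.KinematicFormulas.<Decl> := …` in Summits/KontsevichZagierPeriods/KontsevichZagierPeriods/Theorems/<Name>.lean.
-/

namespace Summit.KontsevichZagierPeriods.KontsevichZagierPeriods.Theses.KinematicFormulas

open scoped BigOperators Topology Manifold Classical MeasureTheory ProbabilityTheory Matrix InnerProductSpace ComplexConjugate ContinuousMap
open Filter Set Function TopologicalSpace MeasureTheory

attribute [summit_statement] _root_.KontsevichZagierPeriods

open Literature Periods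

/-- item stmt-KontsevichZagierPeriods-10863 · crux (kind.auto-crux: conjecture-grade) · rank 0 · open · by planner
why it might fail: GPC-strength: modulo KinematicPlaneConvexR it is equivalent to KZKernelConjecture, so the strength barriers (oddZeta / 2 pi i log / elliptic algebraic independence) bite here; false iff some equal-valued pair stays underivable with the kinematic relators adjoined.
sources: KontsevichZagier2001, HuberMullerStach2017, BernigFu2011
[target] repaired KinematicKernel (stmt-KontsevichZagierPeriods-5393 superseded: as typed its fifth
generator set ranged over ALL compact convex semialgebraic K, L including ∅ and so contained UNSOUND
generators — refuter note 2026-08-15T13:57Z; the conjuncts K.Nonempty ∧ L.Nonempty are added,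
nothing else changes). Kernel conjecture of the enlarged calculus KZ^kin: every formal ℤ-combination
of integral representations with value 0 lies in the subgroup generated by domain additivity,
integrand additivity, change of variables, Newton–Leibniz AND the plane principal-kinematic relators
of KinematicPlaneConvexR (same data: NON-EMPTY compact convex ℚ-semialgebraic K, L ⊂ ℝ², the four
reps r₀, r₁, r₂, r₃). Honest status: modulo KinematicPlaneConvexR it is EQUIVALENT to
Literature.NumberTheory.Transcendental.KZKernelConjecture, hence GPC-strength; filed so that the
engine is load-bearing in the deciding theorem `closes (hE : KinematicPlaneConvexR) (hK :
KinematicKernelR) : KontsevichZagierPeriods` and KZ^kin is on record as a formal object. WHY IT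
MIGHT FAIL: GPC-strength (the strength barriers kzConjecture_implies_oddZetaAlgIndep / _twoPiI_log /
_ellipticPeriods bite here and only here) -/
@[route_item "route-KontsevichZagierPeriods-KinematicFormulas", crux]
def KinematicKernelR : Prop :=
  ∀ c : Literature.NumberTheory.Transcendental.KZ.FormalRep, Literature.NumberTheory.Transcendental.KZ.eval c = 0 → c ∈ AddSubgroup.closure (Literature.NumberTheory.Transcendental.KZ.domainAddRel ∪ Literature.NumberTheory.Transcendental.KZ.integrandAddRel ∪ Literature.NumberTheory.Transcendental.KZ.changeOfVariablesRel ∪ Literature.NumberTheory.Transcendental.KZ.newtonLeibnizRel ∪ {c | ∃ (K L : Set (Fin 2 → ℝ)) (r₀ r₁ r₂ : Literature.NumberTheory.Transcendental.KZ.IntegralRep 3) (r₃ : Literature.NumberTheory.Transcendental.KZ.IntegralRep 4), Literature.ModelTheory.ExponentialFields.IsSemialgebraic ℚ K ∧ Literature.ModelTheory.ExponentialFields.IsSemialgebraic ℚ L ∧ Convex ℝ K ∧ Convex ℝ L ∧ IsCompact K ∧ IsCompact L ∧ K.Nonempty ∧ L.Nonempty ∧ r₀.domain = {x : Fin 3 →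 ℝ | ∃ q ∈ L, (![((1 - x 0 ^ 2) * q 0 - 2 * x 0 * q 1) / (1 + x 0 ^ 2) + x 1, (2 * x 0 * q 0 + (1 - x 0 ^ 2) * q 1) / (1 + x 0 ^ 2) + x 2] : Fin 2 → ℝ) ∈ K} ∧ Set.EqOn r₀.integrand (fun x => 2 / (1 + x 0 ^ 2)) r₀.domain ∧ r₁.domain = {x : Fin 3 → ℝ | (![x 1, x 2] : Fin 2 → ℝ) ∈ K} ∧ Set.EqOn r₁.integrand (fun x => 2 / (1 + x 0 ^ 2)) r₁.domain ∧ r₂.domain = {x : Fin 3 → ℝ | (![x 1, x 2] : Fin 2 → ℝ) ∈ L} ∧ Set.EqOn r₂.integrand (fun x => 2 / (1 + x 0 ^ 2)) r₂.domain ∧ r₃.domain = {z : Fin 4 → ℝ | (0 ≤ z 1 ∧ ∃ q ∈ K, (1 - z 0 ^ 2) * q 0 + 2 * z 0 * q 1 = (1 + z 0 ^ 2) * z 1) ∧ (0 ≤ z 3 ∧ ∃ q ∈ L, (1 - z 2 ^ 2) * q 0 + 2 * z 2 * q 1 = (1 + z 2 ^ 2) * z 3)} ∧ Set.EqOn r₃.integrand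 (fun z => 4 / ((1 + z 0 ^ 2) * (1 + z 2 ^ 2))) r₃.domain ∧ c = Literature.NumberTheory.Transcendental.KZ.of r₀ - Literature.NumberTheory.Transcendental.KZ.of r₁ - Literature.NumberTheory.Transcendental.KZ.of r₂ - Literature.NumberTheory.Transcendental.KZ.of r₃})

/-- item stmt-KontsevichZagierPeriods-10736 · crux · rank 2 · open · by planner
why it might fail: Only as a UNIFORM derivability claim: edges, corners and lower-dimensional bodies degenerate the Gauss-map parametrisation of the boundary of K + (-R L), so one chain schema must stratify every non-empty convex semialgebraic body exactly (limits are not moves).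
sources: SantaloKac2004, SchneiderWeilLNM2007, SchneiderWeil2008, KontsevichZagier2001
[crux] repaired KinematicPlaneConvex (stmt-KontsevichZagierPeriods-5394 refuted-MISSTATED by
Summit.KontsevichZagierPeriods.KinematicFormulas.KinematicFormulasKinematicPlaneConvex_refuted:
witness K = [0,1]², L = ∅): the hypotheses K.Nonempty → L.Nonempty → are added, nothing else
changes. THE PLANE ENGINE: for all NON-EMPTY compact convex ℚ-semialgebraic K, L ⊂ ℝ², Blaschke
principal kinematic relator [Inc(K,L), 2/(1+t²)] − [ℝ_t × K, 2/(1+t²)] − [ℝ_t × L, 2/(1+t²)] −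
[LineHit K × LineHit L, 4/((1+t²)(1+t′²))] ∈ KZ.relations (SE(2) in the tan-half-angle chart).
Values agree for every non-empty pair incl. points and segments (perimeter = 2V₁): m(Inc) = ∫A(K ⊕
−R_φL)dφ = 2π(A_K + A_L) + L_K·L_L, m(ℝ_t × K) = 2πA_K, m(LineHit K) = L_K; checks: two unit discs
8π² = 8π², two segments 4ab = 4ab, point + body 2πA_L = 2πA_L. Foreseen chain as before
(support/Gauss-map CoV, integrand additivity, torus shear (u,φ) ↦ (u,u−φ), Cauchy + Crofton by one
Newton–Leibniz each, domain additivity for edges/corners). WHY IT MIGHT FAIL: only as a UNIFORM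
derivability claim — edges, corners and lower-dimensional bodies degenerate the Gauss-map
parametrisation of ∂(K ⊕ −R_φL), so one chain schema must str -/
@[route_item "route-KontsevichZagierPeriods-KinematicFormulas", crux]
def KinematicPlaneConvexR : Prop :=
  ∀ K L : Set (Fin 2 → ℝ), Literature.ModelTheory.ExponentialFields.IsSemialgebraic ℚ K → Literature.ModelTheory.ExponentialFields.IsSemialgebraic ℚ L → Convex ℝ K → Convex ℝ L → IsCompact K → IsCompact L → K.Nonempty → L.Nonempty → ∀ (r₀ r₁ r₂ : Literature.NumberTheory.Transcendental.KZ.IntegralRep 3) (r₃ : Literature.NumberTheory.Transcendental.KZ.IntegralRep 4), r₀.domain = {x : Fin 3 → ℝ | ∃ q ∈ L, (![((1 - x 0 ^ 2) * q 0 - 2 * x 0 * q 1) / (1 + x 0 ^ 2) + x 1, (2 * x 0 * q 0 + (1 - x 0 ^ 2) * q 1) / (1 + x 0 ^ 2) + x 2] : Fin 2 → ℝ) ∈ K} → Set.EqOn r₀.integrand (fun x => 2 / (1 + x 0 ^ 2)) r₀.domain → r₁.domain = {x : Fin 3 → ℝ | (![x 1, x 2] : Fin 2 → ℝ) ∈ K}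 → Set.EqOn r₁.integrand (fun x => 2 / (1 + x 0 ^ 2)) r₁.domain → r₂.domain = {x : Fin 3 → ℝ | (![x 1, x 2] : Fin 2 → ℝ) ∈ L} → Set.EqOn r₂.integrand (fun x => 2 / (1 + x 0 ^ 2)) r₂.domain → r₃.domain = {z : Fin 4 → ℝ | (0 ≤ z 1 ∧ ∃ q ∈ K, (1 - z 0 ^ 2) * q 0 + 2 * z 0 * q 1 = (1 + z 0 ^ 2) * z 1) ∧ (0 ≤ z 3 ∧ ∃ q ∈ L, (1 - z 2 ^ 2) * q 0 + 2 * z 2 * q 1 = (1 + z 2 ^ 2) * z 3)} → Set.EqOn r₃.integrand (fun z => 4 / ((1 + z 0 ^ 2) * (1 + z 2 ^ 2))) r₃.domain → Literature.NumberTheory.Transcendental.KZ.of r₀ - Literature.NumberTheory.Transcendental.KZ.of r₁ - Literature.NumberTheory.Transcendental.KZ.of r₂ - Literature.NumberTheory.Transcendental.KZ.of r₃ ∈ Literature.NumberTheory.Transcendental.KZ.relations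

/-- item stmt-KontsevichZagierPeriods-6399 · crux · rank 2 · open · by planner
why it might fail: All known proofs are algebraic (Alesker; Bernig-Fu: product, Fourier, hard Lefschetz) or template-based (Park), never a move chain for given K, L; a Kahler-angle isotropy integral needing an arctan primitive is barred (noSemialgebraicPrimitive_inv_sub_two).
sources: BernigFu2011, arXiv:0801.0711, Alesker2003, Fu1990, Howard1993, Park2002
[crux] THE BET (card frontier (d)): the unitary principal kinematic formula in ℂ² is a chain. For
all compact convex ℚ-semialgebraic K, L ⊂ ℂ² = ℝ⁴ (first instances: two ellipsoids with rational
semi-axes, neither a ball, and K = ellipsoid against L = complex / Lagrangian disc), the incidence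
rep [Inc_{U(2)⋉ℂ²}(K,L), haar] (coordinates and density of UnitaryDiscPair: S³×S¹ chart of U(2),
density 16/((1+|w|²)³(1+t²)), Inc = {g : ∃ p ∈ L, g·p ∈ K}) minus Σ_{A,B} c_{A,B}·[Hit_A(K) ×
Hit_B(L), invariant densities] lies in KZ.relations, where A, B range over the U(2)⋉ℂ²-orbit types
of real affine subspaces of ℂ² spanning Val^{U(2)} (dim 6: points = volume, real lines, complex
lines, Lagrangian planes, real hyperplanes, whole space = χ; Alesker2003 Crofton basis), Hit_A(K) =
{E ∈ orbit A : E ∩ K ≠ ∅} as a KZ.IntegralRep domain in a semialgebraic chart of the homogeneous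
space (definition request HermitianHittingRep), and c_{A,B} ∈ ℚ[π, 1/π] are the Bernig–Fu constants
(BernigFu2011 = arXiv:0801.0711, Thm. on k_{U(n)}(χ) and §5, specialised to n = 2 and rewritten in
the Crofton basis; Park2002 obtained n = 2, 3 by the template method) — values to be vendored as a
named fact and re-checked -/
@[route_item "route-KontsevichZagierPeriods-KinematicFormulas"]
def UnitaryKinematicC2 : Prop :=
  ∀ K L : Set (Fin 4 → ℝ), Literature.ModelTheory.ExponentialFields.IsSemialgebraic ℚ K → Literature.ModelTheory.ExponentialFields.IsSemialgebraic ℚ L → Convex ℝ K → Convex ℝ L → IsCompact K → IsCompact L → K.Nonempty → L.Nonempty → ∀ (r₀ r₁ r₂ : Literature.NumberTheory.Transcendental.KZ.IntegralRep 9) (r₃ r₄ : Literature.NumberTheory.Transcendental.KZ.IntegralRep 11) (r₅ r₆ r₇ r₈ : Literature.NumberTheory.Transcendental.KZ.IntegralRep 10), r₀.domain = {x : Fin 9 → ℝ | ∃ q ∈ L, (![(Literature.Geometry.IntegralGeometry.C2.stereoAlpha x * Literature.Geometry.IntegralGeometry.C2.zfst q - (⟨(1 - x 3 ^ 2) / (1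 + x 3 ^ 2), 2 * x 3 / (1 + x 3 ^ 2)⟩ : ℂ) * (starRingEnd ℂ) (Literature.Geometry.IntegralGeometry.C2.stereoBeta x) * Literature.Geometry.IntegralGeometry.C2.zsnd q).re + x 4, (Literature.Geometry.IntegralGeometry.C2.stereoAlpha x * Literature.Geometry.IntegralGeometry.C2.zfst q - (⟨(1 - x 3 ^ 2) / (1 + x 3 ^ 2), 2 * x 3 / (1 + x 3 ^ 2)⟩ : ℂ) * (starRingEnd ℂ) (Literature.Geometry.IntegralGeometry.C2.stereoBeta x) * Literature.Geometry.IntegralGeometry.C2.zsnd q).im + x 5, (Literature.Geometry.IntegralGeometry.C2.stereoBeta x * Literature.Geometry.IntegralGeometry.C2.zfst q + (⟨(1 - x 3 ^ 2) / (1 + x 3 ^ 2), 2 * x 3 / (1 + x 3 ^ 2)⟩ : ℂ) * (starRingEnd ℂ) (Literature.Geometry.IntegralGeometry.C2.stereoAlpha x) * Literature.Geometry.IntegralGeometry.C2.zsnd q).re + x 6, (Literature.Geometry.IntegralGeometry.C2.stereoBeta x * Literature.Geometry.IntegralGeometry.C2.zfst q + (⟨(1 - x 3 ^ 2) / (1 +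 x 3 ^ 2), 2 * x 3 / (1 + x 3 ^ 2)⟩ : ℂ) * (starRingEnd ℂ) (Literature.Geometry.IntegralGeometry.C2.stereoAlpha x) * Literature.Geometry.IntegralGeometry.C2.zsnd q).im + x 7] : Fin 4 → ℝ) ∈ K} → Set.EqOn r₀.integrand (fun x => 16 / (Literature.Geometry.IntegralGeometry.C2.stereoDen x ^ 3 * (1 + x 3 ^ 2)) * (2 / (1 + x 8 ^ 2))) r₀.domain → r₁.domain = {x : Fin 9 → ℝ | (![x 4, x 5, x 6, x 7] : Fin 4 → ℝ) ∈ K} → Set.EqOn r₁.integrand (fun x => 16 / (Literature.Geometry.IntegralGeometry.C2.stereoDen x ^ 3 * (1 + x 3 ^ 2)) * (2 / (1 + x 8 ^ 2))) r₁.domain → r₂.domain = {x : Fin 9 → ℝ | (![x 4, x 5, x 6, x 7] : Fin 4 → ℝ) ∈ L} → Set.EqOn r₂.integrand (fun x => 16 / (Literature.Geometry.IntegralGeometry.C2.stereoDen x ^ 3 * (1 + x 3 ^ 2)) * (2 / (1 + x 8 ^ 2))) r₂.domain → r₃.domain = {x : Fin 11 → ℝ | (![x 1, x 2, x 3, x 4,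 x 5, x 6] : Fin 6 → ℝ) ∈ Literature.Geometry.IntegralGeometry.C2.RealLine.hit K ∧ (![x 7, x 8, x 9, x 10] : Fin 4 → ℝ) ∈ Literature.Geometry.IntegralGeometry.C2.RealHyperplane.hit L} → Set.EqOn r₃.integrand (fun x => 2 / (1 + x 0 ^ 2) * Literature.Geometry.IntegralGeometry.C2.RealLine.density (![x 1, x 2, x 3, x 4, x 5, x 6] : Fin 6 → ℝ) * Literature.Geometry.IntegralGeometry.C2.RealHyperplane.density (![x 7, x 8, x 9, x 10] : Fin 4 → ℝ)) r₃.domain → r₄.domain = {x : Fin 11 → ℝ | (![x 1, x 2, x 3, x 4] : Fin 4 → ℝ) ∈ Literature.Geometry.IntegralGeometry.C2.RealHyperplane.hit K ∧ (![x 5, x 6, x 7, x 8, x 9, x 10] : Fin 6 → ℝ) ∈ Literature.Geometry.IntegralGeometry.C2.RealLine.hit L} → Set.EqOn r₄.integrand (fun x => 2 / (1 + x 0 ^ 2) * Literature.Geometry.IntegralGeometry.C2.RealHyperplane.density (![x 1, x 2, x 3, x 4] : Fin 4 → ℝ) * Literature.Geometry.IntegralGeometry.C2.RealLine.density (![x 5,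 x 6, x 7, x 8, x 9, x 10] : Fin 6 → ℝ)) r₄.domain → r₅.domain = {x : Fin 10 → ℝ | (![x 2, x 3, x 4, x 5] : Fin 4 → ℝ) ∈ Literature.Geometry.IntegralGeometry.C2.ComplexLine.hit K ∧ (![x 6, x 7, x 8, x 9] : Fin 4 → ℝ) ∈ Literature.Geometry.IntegralGeometry.C2.ComplexLine.hit L} → Set.EqOn r₅.integrand (fun x => 2 / (1 + x 0 ^ 2) * (2 / (1 + x 1 ^ 2)) * Literature.Geometry.IntegralGeometry.C2.ComplexLine.density (![x 2, x 3, x 4, x 5] : Fin 4 → ℝ) * Literature.Geometry.IntegralGeometry.C2.ComplexLine.density (![x 6, x 7, x 8, x 9] : Fin 4 → ℝ)) r₅.domain → r₆.domain = {x : Fin 10 → ℝ | (![x 1, x 2, x 3, x 4] : Fin 4 → ℝ) ∈ Literature.Geometry.IntegralGeometry.C2.ComplexLine.hit K ∧ (![x 5, x 6, x 7, x 8, x 9] : Fin 5 → ℝ) ∈ Literature.Geometry.IntegralGeometry.C2.LagrangianPlane.hit L} → Set.EqOn r₆.integrand (fun x => 2 / (1 + x 0 ^ 2) * Literature.Geometry.IntegralGeometry.C2.ComplexLine.density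 (![x 1, x 2, x 3, x 4] : Fin 4 → ℝ) * Literature.Geometry.IntegralGeometry.C2.LagrangianPlane.density (![x 5, x 6, x 7, x 8, x 9] : Fin 5 → ℝ)) r₆.domain → r₇.domain = {x : Fin 10 → ℝ | (![x 1, x 2, x 3, x 4, x 5] : Fin 5 → ℝ) ∈ Literature.Geometry.IntegralGeometry.C2.LagrangianPlane.hit K ∧ (![x 6, x 7, x 8, x 9] : Fin 4 → ℝ) ∈ Literature.Geometry.IntegralGeometry.C2.ComplexLine.hit L} → Set.EqOn r₇.integrand (fun x => 2 / (1 + x 0 ^ 2) * Literature.Geometry.IntegralGeometry.C2.LagrangianPlane.density (![x 1, x 2, x 3, x 4, x 5] : Fin 5 → ℝ) * Literature.Geometry.IntegralGeometry.C2.ComplexLine.density (![x 6, x 7, x 8, x 9] : Fin 4 → ℝ)) r₇.domain → r₈.domain = {x : Fin 10 → ℝ | (![x 0, x 1, x 2, x 3, x 4] : Fin 5 → ℝ) ∈ Literature.Geometry.IntegralGeometry.C2.LagrangianPlane.hit K ∧ (![x 5, x 6, x 7, x 8, x 9] : Fin 5 → ℝ) ∈ Literature.Geometry.IntegralGeometry.C2.LagrangianPlane.hit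 L} → Set.EqOn r₈.integrand (fun x => Literature.Geometry.IntegralGeometry.C2.LagrangianPlane.density (![x 0, x 1, x 2, x 3, x 4] : Fin 5 → ℝ) * Literature.Geometry.IntegralGeometry.C2.LagrangianPlane.density (![x 5, x 6, x 7, x 8, x 9] : Fin 5 → ℝ)) r₈.domain → Literature.NumberTheory.Transcendental.KZ.of r₀ - Literature.NumberTheory.Transcendental.KZ.of r₁ - Literature.NumberTheory.Transcendental.KZ.of r₂ - 3 • Literature.NumberTheory.Transcendental.KZ.of r₃ - 3 • Literature.NumberTheory.Transcendental.KZ.of r₄ - 6 • Literature.NumberTheory.Transcendental.KZ.of r₅ + 8 • Literature.NumberTheory.Transcendental.KZ.of r₆ + 8 • Literature.NumberTheory.Transcendental.KZ.of r₇ - 32 • Literature.NumberTheory.Transcendental.KZ.of r₈ ∈ Literature.NumberTheory.Transcendental.KZ.relations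

/-- item stmt-KontsevichZagierPeriods-5395 · crux · rank 4 · open · by planner
why it might fail: The 2 pi of the S^1 factor must be traded for 16 half-discs of radius 1/2 inside an 8-dim chain with transversality null sets; as typed, a slip in the conj/sign conventions of u or in the Haar density makes the values differ and then the negation is provable by soundness.
sources: BernigFu2011, Alesker2003, Howard1993, KontsevichZagier2001
[crux] THE FLAT END OF HERMITIAN INTEGRAL GEOMETRY (card frontier (d), first rung). Coordinates x ∈
ℝ⁸ on U(2)⋉ℂ²: (x₀,x₁,x₂) ↦ (α, β) ∈ S³ ⊂ ℂ² by inverse stereographic projection (α = (2x₀+2x₁i)/D,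
β = (2x₂ + (|w|²−1)i)/D, D = 1+|w|²), x₃ ↦ λ = ((1−x₃²)+2x₃i)/(1+x₃²) ∈ S¹, u = [[α, −λβ̄],[β, λᾱ]]
(a bijection S³×S¹ → U(2) pushing round×round to Haar), v = (x₄+x₅i, x₆+x₇i), Haar density
16/(D³(1+x₃²)). K = closed unit disc of the complex line ℂe₁; L = K; L′ = closed unit disc of the
Lagrangian plane ℝ² ⊂ ℂ²; Inc(K,M) = {(u,v) : ∃ p ∈ M, up + v ∈ K} written out
quantifier-explicitly. Claim: KZ.of [Inc(K,L), haar] − 2 • KZ.of [Inc(K,L′), haar] ∈ KZ.relations —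
a random unitary motion makes a Lagrangian disc meet a complex disc exactly HALF as often as a
complex disc (the two pairs are congruent under SO(4)⋉ℝ⁴, so the identity is invisible to real
integral geometry: it is the (2,2) Kähler-angle constant at its flat end). Values: translation
fibres have 4-volume π²|β|² resp. π²|Im(β̄λᾱ)|, with Haar means 1/2 and 1/4 (Archimedes on S³;
B(3/2,3/2) = π/8 = area of a half-disc of radius 1/2); Monte-Carlo of the coordinate formulas, fibre
volumes and means in the planner folder num/unitary -/
@[route_item "route-KontsevichZagierPeriods-KinematicFormulas"]
def UnitaryDiscPair : Prop :=
  ∀ (r r' : Literature.NumberTheory.Transcendental.KZ.IntegralRep 8), r.domain = {x : Fin 8 → ℝ | ∃ p : ℂ, ‖p‖ ≤ 1 ∧ p * (⟨2 * x 2 / (1 + x 0 ^ 2 + x 1 ^ 2 + x 2 ^ 2), (x 0 ^ 2 + x 1 ^ 2 + x 2 ^ 2 - 1) / (1 + x 0 ^ 2 + x 1 ^ 2 + x 2 ^ 2)⟩ : ℂ) + ⟨x 6, x 7⟩ = 0 ∧ ‖p * (⟨2 * x 0 / (1 + x 0 ^ 2 + x 1 ^ 2 + x 2 ^ 2), 2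 * x 1 / (1 + x 0 ^ 2 + x 1 ^ 2 + x 2 ^ 2)⟩ : ℂ) + ⟨x 4, x 5⟩‖ ≤ 1} → Set.EqOn r.integrand (fun x => 16 / ((1 + x 0 ^ 2 + x 1 ^ 2 + x 2 ^ 2) ^ 3 * (1 + x 3 ^ 2))) r.domain → r'.domain = {x : Fin 8 → ℝ | ∃ a b : ℝ, a ^ 2 + b ^ 2 ≤ 1 ∧ (a : ℂ) * (⟨2 * x 2 / (1 + x 0 ^ 2 + x 1 ^ 2 + x 2 ^ 2), (x 0 ^ 2 + x 1 ^ 2 + x 2 ^ 2 - 1) / (1 + x 0 ^ 2 + x 1 ^ 2 + x 2 ^ 2)⟩ : ℂ) + (b : ℂ) * (⟨(1 - x 3 ^ 2) / (1 + x 3 ^ 2), 2 * x 3 / (1 + x 3 ^ 2)⟩ : ℂ) * (starRingEnd ℂ) (⟨2 * x 0 / (1 + x 0 ^ 2 + x 1 ^ 2 + x 2 ^ 2), 2 * x 1 / (1 + x 0 ^ 2 + x 1 ^ 2 + x 2 ^ 2)⟩ : ℂ) + ⟨x 6, x 7⟩ = 0 ∧ ‖(a : ℂ) * (⟨2 * x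 0 / (1 + x 0 ^ 2 + x 1 ^ 2 + x 2 ^ 2), 2 * x 1 / (1 + x 0 ^ 2 + x 1 ^ 2 + x 2 ^ 2)⟩ : ℂ) - (b : ℂ) * (⟨(1 - x 3 ^ 2) / (1 + x 3 ^ 2), 2 * x 3 / (1 + x 3 ^ 2)⟩ : ℂ) * (starRingEnd ℂ) (⟨2 * x 2 / (1 + x 0 ^ 2 + x 1 ^ 2 + x 2 ^ 2), (x 0 ^ 2 + x 1 ^ 2 + x 2 ^ 2 - 1) / (1 + x 0 ^ 2 + x 1 ^ 2 + x 2 ^ 2)⟩ : ℂ) + ⟨x 4, x 5⟩‖ ≤ 1} → Set.EqOn r'.integrand (fun x => 16 / ((1 + x 0 ^ 2 + x 1 ^ 2 + x 2 ^ 2) ^ 3 * (1 + x 3 ^ 2))) r'.domain → Literature.NumberTheory.Transcendental.KZ.of r - 2 • Literature.NumberTheory.Transcendental.KZ.of r' ∈ Literature.NumberTheory.Transcendental.KZ.relations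

/-- item stmt-KontsevichZagierPeriods-5396 · crux · rank 5 · open · by planner
why it might fail: The multiplicity #(dE cap g dE') in {0,...,4} jumps across the tangency discriminant (degree 8 in g); the chain needs an explicit semialgebraic partition of (s,s',psi)-space into injectivity sheets of the contact map plus semialgebraicity of the ncard integrand.
sources: SantaloKac2004, Howard1993, BCR1998
[crux] POINCARÉ'S FORMULA WITH THE COUNTING INTEGRAND (card item (K), Poincaré). For rational a, b,
c, d > 0, E = {b²x² + a²y² ≤ a²b²}, E′ = {d²x² + c²y² ≤ c²d²}: r₀ = [ℝ³ = SE(2), #(∂E ∩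
g∂E′)·2/(1+t²)] (integrand via Set.ncard; g⁻¹q = R_(−φ)(q − v); the count is ≤ 4 off the null set of
g with gE′ = E) and r₃ = [LineHit E × LineHit E′, 4/((1+t²)(1+t′²))] satisfy KZ.of r₀ − 4 • KZ.of r₃
∈ KZ.relations (Poincaré ∫#(∂E ∩ g∂E′)dg = 4·L_E·L_E′, SantaloKac2004 §I.7, checked by hand on two
circles: 16π²R₀R₁ both sides; Crofton for the lengths). Mechanism: Federer's AREA FORMULA with
variable multiplicity for the semialgebraic map (s, s′, ψ) ↦ g (contact parametrisation, Jacobian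
|sin ψ|) — route MultivaluedCoV's SheetTransfer with a piecewise-constant sheet count — plus ∫|sin
ψ|dψ = 4 as one Newton–Leibniz move per sign cell with a rational primitive, plus CroftonEllipse
twice. [difficulty: M] -/
@[route_item "route-KontsevichZagierPeriods-KinematicFormulas"]
def PoincareConics : Prop :=
  ∀ a b c d : ℚ, 0 < a → 0 < b → 0 < c → 0 < d → ∀ (r₀ : Literature.NumberTheory.Transcendental.KZ.IntegralRep 3) (r₃ : Literature.NumberTheory.Transcendental.KZ.IntegralRep 4), r₀.domain = Set.univ → Set.EqOn r₀.integrand (fun x => (Set.ncard {q : Fin 2 → ℝ | (b : ℝ) ^ 2 * q 0 ^ 2 + (a : ℝ) ^ 2 * q 1 ^ 2 = (a : ℝ) ^ 2 * (b : ℝ) ^ 2 ∧ (d : ℝ) ^ 2 * (((1 - x 0 ^ 2) * (q 0 - x 1) + 2 * x 0 * (q 1 - x 2)) / (1 + x 0 ^ 2)) ^ 2 + (c : ℝ) ^ 2 * ((-(2 * x 0) * (q 0 - x 1) + (1 - x 0 ^ 2) * (q 1 - x 2)) / (1 + x 0 ^ 2)) ^ 2 = (c : ℝ) ^ 2 * (d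 : ℝ) ^ 2} : ℝ) * (2 / (1 + x 0 ^ 2))) r₀.domain → r₃.domain = {z : Fin 4 → ℝ | (0 ≤ z 1 ∧ ∃ q : Fin 2 → ℝ, (b : ℝ) ^ 2 * q 0 ^ 2 + (a : ℝ) ^ 2 * q 1 ^ 2 ≤ (a : ℝ) ^ 2 * (b : ℝ) ^ 2 ∧ (1 - z 0 ^ 2) * q 0 + 2 * z 0 * q 1 = (1 + z 0 ^ 2) * z 1) ∧ (0 ≤ z 3 ∧ ∃ q : Fin 2 → ℝ, (d : ℝ) ^ 2 * q 0 ^ 2 + (c : ℝ) ^ 2 * q 1 ^ 2 ≤ (c : ℝ) ^ 2 * (d : ℝ) ^ 2 ∧ (1 - z 2 ^ 2) * q 0 + 2 * z 2 * q 1 = (1 + z 2 ^ 2) * z 3)} → Set.EqOn r₃.integrand (fun z => 4 / ((1 + z 0 ^ 2) * (1 + z 2 ^ 2))) r₃.domain → Literature.NumberTheory.Transcendental.KZ.of r₀ - 4 • Literature.NumberTheory.Transcendental.KZ.of r₃ ∈ Literature.NumberTheory.Transcendental.KZ.relations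

/-- item stmt-KontsevichZagierPeriods-5397 · support · rank 9 · closed · proved by Summit.KontsevichZagierPeriods.KinematicFormulas.croftonEllipse_proof @ 46c05c195dc9 (prover) · by planner
sources: SantaloKac2004, KontsevichZagier2001
[support] Crofton–Cauchy for the ellipse, the cheapest calibration (card item (C)): for rational a,
b > 0, KZ.of [LineHit(E_(a,b)), 2/(1+t²)] − KZ.of [ℝ, 2√(4a²s² + b²(1−s²)²)/(1+s²)²] ∈ KZ.relations
— the measure of lines meeting the ellipse equals its perimeter 4aE(e), a complete elliptic integral
of the second kind (KontsevichZagier2001 §1.1 lists it among the first periods), here as arc length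
over the rational parametrisation s ↦ (a(1−s²)/(1+s²), 2bs/(1+s²)). Two or three moves: NL in p
(primitive 2p/(1+t²)), then the Möbius quarter-turn t ↦ (1+t)/(1−t) exchanging the support-function
and speed integrands of the ellipse, plus null-set bookkeeping. [difficulty: provable-now] -/
@[route_item "route-KontsevichZagierPeriods-KinematicFormulas"]
def CroftonEllipse : Prop :=
  ∀ a b : ℚ, 0 < a → 0 < b → ∀ (r : Literature.NumberTheory.Transcendental.KZ.IntegralRep 2) (r' : Literature.NumberTheory.Transcendental.KZ.IntegralRep 1), r.domain = {y : Fin 2 → ℝ | 0 ≤ y 1 ∧ ∃ q : Fin 2 → ℝ, (b : ℝ) ^ 2 * q 0 ^ 2 + (a : ℝ) ^ 2 * q 1 ^ 2 ≤ (a : ℝ) ^ 2 * (b : ℝ) ^ 2 ∧ (1 - y 0 ^ 2) * q 0 + 2 * y 0 * q 1 = (1 + y 0 ^ 2) * y 1} → Set.EqOn r.integrand (fun y => 2 / (1 + y 0 ^ 2)) r.domain → r'.domain = Set.univ → Set.EqOn r'.integrand (fun s => 2 * Real.sqrt (4 * (a : ℝ) ^ 2 * s 0 ^ 2 + (b : ℝ)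 ^ 2 * (1 - s 0 ^ 2) ^ 2) / (1 + s 0 ^ 2) ^ 2) r'.domain → Literature.NumberTheory.Transcendental.KZ.of r - Literature.NumberTheory.Transcendental.KZ.of r' ∈ Literature.NumberTheory.Transcendental.KZ.relations

/-- item stmt-KontsevichZagierPeriods-5398 · support · rank 9 · closed · proved by Summit.KontsevichZagierPeriods.KinematicFormulas.schurSO3_proof @ c8728cf646b8 (prover) · by planner
sources: CollinsSniady2006, KontsevichZagier2001
[support] FINITE AVERAGING calibrated (card item (F)): Schur orthogonality ∫_SO(3) R₁₁² dg =
(1/3)∫_SO(3) dg inside the rules. Gnomonic Euler–Rodrigues coordinates w ∈ ℝ³ (unit quaternion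
(1,w)/√(1+|w|²), one chart for SO(3) = ℝP³ up to a null set), Haar density EXACTLY (1+|w|²)⁻² (total
mass π² = vol ℝP³), R₁₁ = (1 + x² − y² − z²)/(1+|w|²): 3 • KZ.of [ℝ³, R₁₁²·haar] − KZ.of [ℝ³, haar]
∈ KZ.relations. Chain: left multiplication by the rotations of the cube that permute the coordinate
axes is a RATIONAL measure-preserving change of variables w ↦ w′ (quaternion product, defined off a
null plane) carrying R₁₁² to R₂₁², R₃₁²; integrand additivity and R₁₁² + R₂₁² + R₃₁² = 1 close it —
Haar integration (Weingarten calculus, CollinsSniady2006) replaced by finitely many rational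
rotations, no limits. [difficulty: provable-now] -/
@[route_item "route-KontsevichZagierPeriods-KinematicFormulas"]
def SchurSO3 : Prop :=
  ∀ (r r' : Literature.NumberTheory.Transcendental.KZ.IntegralRep 3), r.domain = Set.univ → Set.EqOn r.integrand (fun w => (1 + w 0 ^ 2 - w 1 ^ 2 - w 2 ^ 2) ^ 2 / (1 + w 0 ^ 2 + w 1 ^ 2 + w 2 ^ 2) ^ 4) r.domain → r'.domain = Set.univ → Set.EqOn r'.integrand (fun w => 1 / (1 + w 0 ^ 2 + w 1 ^ 2 + w 2 ^ 2) ^ 2) r'.domain → 3 • Literature.NumberTheory.Transcendental.KZ.of r - Literature.NumberTheory.Transcendental.KZ.of r' ∈ Literature.NumberTheory.Transcendental.KZ.relations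

-- earlier Assembly (stmt-KontsevichZagierPeriods-5399, replaced 2026-08-15T16:39:54Z -> stmt-KontsevichZagierPeriods-11057): retired by None — KinematicPlaneConvex → KinematicKernel → KontsevichZagierPeriods
/-- item stmt-KontsevichZagierPeriods-11057 · assembly · rank 1 · closed · proved by Summit.KontsevichZagierPeriods.KinematicFormulas.assembly_proof @ 7343233001e8 (prover) · by planner
sources: KontsevichZagier2001, HuberMullerStach2017
[assembly] KinematicPlaneConvexR → KinematicKernelR → KontsevichZagierPeriods (the repaired engine
and target; proved by the deciding theorem closes: AddSubgroup.closure_le with the four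
KZ.*Rel_subset_relations lemmas and KinematicPlaneConvexR for the fifth generator set, then the
kernel-to-statement step of Theorems/KernelFormKernelImpliesStatement inlined). -/
@[route_item "route-KontsevichZagierPeriods-KinematicFormulas"]
def Assembly : Prop :=
  KinematicPlaneConvexR → KinematicKernelR → KontsevichZagierPeriods

-- records of items no longer active in this route (dropped / restated):
-- earlier KinematicPlaneConvex (stmt-KontsevichZagierPeriods-5394, dropped 2026-08-15T16:43:29Z): refuted by Summit.KontsevichZagierPeriods.KinematicFormulas.KinematicFormulasKinematicPlaneConvex_refuted @ 22f638522b28 — ∀ K L : Set (Fin 2 → ℝ), Literature.ModelTheory.ExponentialFields.IsSemialgebraic ℚ K → Literature.ModelTheory.ExponentialFields.IsSemialgebraic ℚ L → Convex ℝ K → Convex ℝ L → IsCo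

/-! D-0027 §2.1 — DECIDING THEOREM (planner-authored via `route open/edit --closes-file`; by planner-rbadge-KontsevichZagierPeriods-Kinemat-a9ca20ad-g2-0 2026-08-15T16:40:47Z):
its hypotheses are this route's items and its conclusion the sub-problem Statement (glue_lint), and it elaborates with this file. -/

@[closes "route-KontsevichZagierPeriods-KinematicFormulas"] theorem closes (hE : KinematicPlaneConvexR) (hK : KinematicKernelR) : KontsevichZagierPeriods := by
  intro n m r r' _ _ hv
  have h0 : Literature.NumberTheory.Transcendental.KZ.eval
      (Literature.NumberTheory.Transcendental.KZ.of r - Literature.NumberTheory.Transcendental.KZ.of r') = 0 := by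
    simp [Literature.NumberTheory.Transcendental.KZ.eval_of, hv]
  show Literature.NumberTheory.Transcendental.KZ.of r - Literature.NumberTheory.Transcendental.KZ.of r' ∈
    Literature.NumberTheory.Transcendental.KZ.relations
  refine (AddSubgroup.closure_le _).mpr ?_ (hK _ h0)
  rintro x ((((hx | hx) | hx) | hx) | hx)
  · exact Literature.NumberTheory.Transcendental.KZ.domainAddRel_subset_relations hx
  · exact Literature.NumberTheory.Transcendental.KZ.integrandAddRel_subset_relations hx
  · exact Literature.NumberTheory.Transcendental.KZ.changeOfVariablesRel_subset_relations hx
  · exact Literature.NumberTheory.Transcendental.KZ.newtonLeibnizRel_subset_relations hx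
  · obtain ⟨K, L, r₀, r₁, r₂, r₃, hK, hL, hcK, hcL, hKc, hLc, hKn, hLn, h0d, h0i, h1d, h1i, h2d, h2i,
      h3d, h3i, rfl⟩ := hx
    exact hE K L hK hL hcK hcL hKc hLc hKn hLn r₀ r₁ r₂ r₃ h0d h0i h1d h1i h2d h2i h3d h3i

end Summit.KontsevichZagierPeriods.KontsevichZagierPeriods.Theses.KinematicFormulas
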